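import Summits.RiemannHypothesis.RiemannHypothesis.Theorems.TiltedLandingLaw421R3Lens1ArcSignJ
import Summits.RiemannHypothesis.RiemannHypothesis.Theorems.TiltedLandingLaw421R3NestedSign

/-!
# TiltedLandingLaw421R3 — lens-1 (part K): bad points live in the LENS; the FOOT ARC; ORDER ⇒ the atomic SHAPE law

LENS-1 gen-7 module image `rh33346-cover/lens-1/AtomicLens-v1.lean` (landing target `…/Theorems/TiltedLandingLaw421R3Lens1ArcSignK.lean`; imports part J
= image `lens-1/AtomicSplit-v1.lean` d20ba21dd3d75e0e until it is tree, and the tree kernel `…R3NestedSign` (`RhW08.NestedSign.exists_cofactor`,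
`im_mul_im_logDeriv_nonpos`, `im_mul_normSq_of_crit`); namespace `RhW08.Lens1ArcSign`; 0 `sorry`; checked BY CHAIN `lens-1/AtomicSplitLens-v1-chain.lean`).
SUMMON (O7-2) of director-rh g25: the ATOMIC RUNG attempt.

CONTENT. §1 lens geometry: `circleLoop_ofReal_re`, `normSq_sub_of_onCircle`, ★ `lens_mono_right` / `lens_mono_left` (membership of `D_v` is MONOTONE toward
the `v`-side foot along the circle) and `lens_initial_segment` (in `t`: for `Re a ≤ Re v` the lens `J = C ∩ D_v` meets the upper semicircle in an INITIAL
`t`-segment at the right foot) · §2 ★★ `bad_subset_lens` (PROVED, «BadInLens»): on a legal frame, if `v ≠ a` is a SIMPLE upper zero of `f^{(j)}` and every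
OTHER upper zero is strictly disc-apart from `a`, then for `0 < δ < g` (the uniform far gap) every upper point `w` of the circle `|w − Re a| = Im a + δ` with
`Im φ(w) > 0` lies in the open lens: `‖w − Re v‖ < Im v` — by global pair removal `f^{(j)} = pairQ · h`, the Jensen sign lemma for `h` (`w` is Jensen-clear
for `h`), and `Im (2(w − Re v)/pairQ(w)) · |pairQ(w)|² = 2 Im w (Im v² − ‖w − Re v‖²)`; corollary `bad_subset_lens_of_atomic` · §3 ORDER: `ArcOrder f j a δ`
(:= for bad pieces `(t₁,t₂)`, `(t₃,t₄)` with `t₂ ≤ t₃`: `Re φ(t₂) ≤ Re φ(t₃)` — C6ʼs «hi_i ≤ lo_j», tilt included, mirror-invariant), ★ `AtomicOrderLawQ`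
(OPEN), and the PROVED reduction `ascStarts_subsingleton_of_order` ⇒ `atomicShapeLaw_of_orderLaw : AtomicOrderLawQ → AtomicShapeLawQ` (two ascending
pieces `P < P′` would need `Re φ(end P) > 0 > Re φ(start P′)`), hence `topPinningResidual_of_orderSplit : AtomicOrderLawQ → NonAtomicTopResidualQ →
TopPinningNonNestedAscResidual`.

VERDICTS on C6ʼs regularities (SUMMON (O7-2); EngineHyps5 + one-mate geometry vs new input):
* BadInLens — PROVED here (frame + simplicity of `v` + far-ness of the third zeros from `a`; neither `NoTallerToucher` nor interiority is used).
* FOOT ARC — PROVED here (pure geometry: on `‖w − Re a‖ = r`, `‖w − Re v‖² = r² + (Re v − Re a)² − 2(Re v − Re a)(Re w − Re a)` is affine decreasing in `Re w`).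
* ORDER — NEEDS NEW INPUT: the nodal-domain topology of `Im φ` inside `D_a` (C6 g37 §2.6 Proposition: the negative tongue between two pieces (i) meets `C_a`
  only along the gap and (ii) carries no real zero of `f^{(j)}` on its boundary; then `Re φ` increases along the sealing arc by Cauchy–Riemann).  Why it might
  fail: a tooth on the tongueʼs boundary flips `Re φ` from `+∞` to `−∞`, or the tongue reaches a second arc; census 0 / 5 845 two-piece + 0 / 247 360 adversarial
  tooth insertions (g37), 174/174 + 75/75 (g38), never refuted, unproved.
* (S*a) «≤ 2 pieces in J, the first at the foot» — NEEDS NEW INPUT: a zero-count for the one-variable function `K_{k,m}(c)` on `J` (convexity trick of C6ʼs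
  Theorem A covers backgrounds (k teeth, 0 pairs) on the exact circle; one exterior pair = cubic; ≥ 2 pairs open).  Why it might fail: a third piece for two
  exterior pairs + teeth (0 in 522 885, not adversarially climbed for three pieces); NOT needed once ORDER holds.
* (S*b) «foot piece and hump never ascend together» — ⟸ ORDER (disjoint tilt windows); nothing separate to prove.
LARGEST PROVABLE SUB-CLASS NOW: none beyond the trivial ones inside EngineHyps5 (Theorem Aʼs class «no exterior pair at all» is a statement about toy
products `e^{gz}·poly`, whose transversality-in-δ step is configuration-wise; typing it as a frame sub-class buys no registry row) — recorded, not typed.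

HONEST LABEL: two lemmas and one reduction; `AtomicOrderLawQ`, `AtomicShapeLawQ`, `NonAtomicTopResidualQ`, `TopPinning`, 33346, 33347 OPEN; nothing here bears
on the truth of RH; RH is not proved; checked ≠ landed ≠ proved.
-/

noncomputable section

namespace RhW08.Lens1ArcSign

open Complex Set Metric Filter Topology
open scoped Real ComplexConjugate
open Literature.Topology.PlaneTopology Literature.Analysis.Complex
open Summit.RiemannHypothesis.RiemannHypothesis.Theorems.Splittings.JensenWindow
open RhIdea6.G17.W07C7 RhIdea6.G17.W07C7.Rev6 RhIdea6.G18.W07C8.Law421BirthS RhIdea6.G19.W07C11.Seam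
open RhIdea6.G20.W07C12.Frac RhIdea6.G20.W07C12.StColP RhW07.C12.FieldSplit RhIdea6.G21.W07C13.TentMax
open RhW07.C14.TwoSided RhW07.C14.Classes RhW07.C14.Lineage RhW07.C14.Booking
open RhW07.C13.Heredity RhIdea6.G22.W07C15pre.Injection RhW07.E3.Cell RhW07.E3.Lit
open RhW08.Round1 RhW08.StSwap RhW08.Round2 RhW08.QuadW RhW08.SealSwapQ RhW08.SealSwap RhW08.SuccB RhW08.SuccSplit
open RhW08.SuccTheft RhW08.Column RhW08.Hurwitz RhW08.ClusterQ RhW08.ClusterQM RhW08.NewtonDoor RhW08.NewtonDoorGenusOne RhW08.PurseP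
open RhW08.Lens1SignCut RhW08.Lens1Coverage RhW08.IsolatedTilt RhW08.Lens1Pinning RhW08.Lens1PinningIso

/-! ## §1 Geometry of the lens `J = C ∩ D_v` -/

/-- `Re` along the circle loop of real centre `c`: `c + r cos 2πt`. -/
theorem circleLoop_ofReal_re (c r t : ℝ) : (circleLoop (c : ℂ) r t).re = c + r * Real.cos (2 * π * t) := by
  have e : (2 * ↑π * ↑t * I : ℂ) = ((2 * π * t : ℝ) : ℂ) * I := by push_cast; ring
  rw [circleLoop_apply, e, add_re, ofReal_re, re_ofReal_mul, exp_ofReal_mul_I_re]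

/-- On the circle `‖w − p‖ = r`: `‖w − x‖² = r² + (x − p)² − 2(x − p)(Re w − p)` — AFFINE and, for `x ≥ p`, DECREASING in `Re w`. -/
theorem normSq_sub_of_onCircle {w : ℂ} {p r : ℝ} (x : ℝ) (hw : ‖w - (p : ℂ)‖ = r) :
    ‖w - (x : ℂ)‖ ^ 2 = r ^ 2 + (x - p) ^ 2 - 2 * (x - p) * (w.re - p) := by
  have e1 : ‖w - (p : ℂ)‖ ^ 2 = (w.re - p) ^ 2 + w.im ^ 2 := by rw [Complex.sq_norm, Complex.normSq_apply]; simp; ring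
  have e2 : ‖w - (x : ℂ)‖ ^ 2 = (w.re - x) ^ 2 + w.im ^ 2 := by rw [Complex.sq_norm, Complex.normSq_apply]; simp; ring
  rw [hw] at e1
  rw [e2, e1]
  ring

/-- ★ FOOT ARC, `v` on the right (`p ≤ x`): membership of the open lens `‖· − x‖ < y` is monotone toward the RIGHT foot along the circle. -/
theorem lens_mono_right {w w' : ℂ} {p r x y : ℝ} (hw : ‖w - (p : ℂ)‖ = r) (hw' : ‖w' - (p : ℂ)‖ = r) (hpx : p ≤ x) (hre : w.re ≤ w'.re)
    (hin : ‖w - (x : ℂ)‖ < y) : ‖w' - (x : ℂ)‖ < y := by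
  have h1 := normSq_sub_of_onCircle x hw
  have h2 := normSq_sub_of_onCircle x hw'
  have hle : ‖w' - (x : ℂ)‖ ^ 2 ≤ ‖w - (x : ℂ)‖ ^ 2 := by rw [h1, h2]; nlinarith
  exact ((pow_le_pow_iff_left₀ (norm_nonneg _) (norm_nonneg _) two_ne_zero).1 hle).trans_lt hin

/-- FOOT ARC, `v` on the left (`x ≤ p`): monotone toward the LEFT foot. -/
theorem lens_mono_left {w w' : ℂ} {p r x y : ℝ} (hw : ‖w - (p : ℂ)‖ = r) (hw' : ‖w' - (p : ℂ)‖ = r) (hxp : x ≤ p) (hre : w'.re ≤ w.re)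
    (hin : ‖w - (x : ℂ)‖ < y) : ‖w' - (x : ℂ)‖ < y := by
  have h1 := normSq_sub_of_onCircle x hw
  have h2 := normSq_sub_of_onCircle x hw'
  have hle : ‖w' - (x : ℂ)‖ ^ 2 ≤ ‖w - (x : ℂ)‖ ^ 2 := by rw [h1, h2]; nlinarith
  exact ((pow_le_pow_iff_left₀ (norm_nonneg _) (norm_nonneg _) two_ne_zero).1 hle).trans_lt hin

/-- ★ In the parameter `t` (`v` on the right, `Re a ≤ Re v`): the lens meets the upper semicircle `t ∈ [0, ½]` in an INITIAL segment at the right foot. -/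
theorem lens_initial_segment {a v : ℂ} {δ t t' : ℝ} (hr : 0 ≤ a.im + δ) (hav : a.re ≤ v.re) (ht : 0 ≤ t) (htt' : t ≤ t') (ht' : t' ≤ 1 / 2)
    (hin : ‖circleLoop (a.re : ℂ) (a.im + δ) t' - (v.re : ℂ)‖ < v.im) : ‖circleLoop (a.re : ℂ) (a.im + δ) t - (v.re : ℂ)‖ < v.im := by
  have hγ : ∀ s : ℝ, ‖circleLoop (a.re : ℂ) (a.im + δ) s - (a.re : ℂ)‖ = a.im + δ := fun s => by
    rw [norm_circleLoop_sub_center, abs_of_nonneg hr]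
  refine lens_mono_right (hγ t') (hγ t) hav ?_ hin
  rw [circleLoop_ofReal_re, circleLoop_ofReal_re]
  have hcos : Real.cos (2 * π * t') ≤ Real.cos (2 * π * t) :=
    Real.cos_le_cos_of_nonneg_of_le_pi (by positivity) (by nlinarith [Real.pi_pos]) (by nlinarith [Real.pi_pos])
  nlinarith [mul_le_mul_of_nonneg_left hcos hr]

/-- The mirror statement (`Re v ≤ Re a`): a FINAL segment at the left foot. -/
theorem lens_final_segment {a v : ℂ} {δ t t' : ℝ} (hr : 0 ≤ a.im + δ) (hva : v.re ≤ a.re) (ht : 0 ≤ t) (htt' : t ≤ t') (ht' : t' ≤ 1 / 2)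
    (hin : ‖circleLoop (a.re : ℂ) (a.im + δ) t - (v.re : ℂ)‖ < v.im) : ‖circleLoop (a.re : ℂ) (a.im + δ) t' - (v.re : ℂ)‖ < v.im := by
  have hγ : ∀ s : ℝ, ‖circleLoop (a.re : ℂ) (a.im + δ) s - (a.re : ℂ)‖ = a.im + δ := fun s => by
    rw [norm_circleLoop_sub_center, abs_of_nonneg hr]
  refine lens_mono_left (hγ t) (hγ t') hva ?_ hin
  rw [circleLoop_ofReal_re, circleLoop_ofReal_re]
  have hcos : Real.cos (2 * π * t') ≤ Real.cos (2 * π * t) :=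
    Real.cos_le_cos_of_nonneg_of_le_pi (by positivity) (by nlinarith [Real.pi_pos]) (by nlinarith [Real.pi_pos])
  nlinarith [mul_le_mul_of_nonneg_left hcos hr]

/-! ## §2 BadInLens: every bad point of a small circle lies in the open lens -/

/-- The uniform far gap keeps every point of the circle of radius `Im a + δ`, `δ < g`, Jensen-clear of a far zero `c`. -/
theorem im_lt_norm_sub_of_gap {a c w : ℂ} {δ g : ℝ} (hw : ‖w - (a.re : ℂ)‖ = a.im + δ) (hδg : δ < g)
    (hgap : a.im + |c.im| + g ≤ |a.re - c.re|) : |c.im| < ‖w - (c.re : ℂ)‖ := by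
  have h1 : |w.re - c.re| ≤ ‖w - (c.re : ℂ)‖ := by
    have := abs_re_le_norm (w - (c.re : ℂ)); rwa [sub_re, ofReal_re] at this
  have h2 : |w.re - a.re| ≤ a.im + δ := by
    have := abs_re_le_norm (w - (a.re : ℂ)); rw [sub_re, ofReal_re, hw] at this; exact this
  have h3 : |a.re - c.re| ≤ |a.re - w.re| + |w.re - c.re| := abs_sub_le a.re w.re c.re
  rw [abs_sub_comm a.re w.re] at h3
  linarith

set_option maxHeartbeats 800000 in
/-- ★★ BadInLens (PROVED).  Legal frame; `v ≠ a` a SIMPLE upper zero of `f^{(j)}`; every other upper zero strictly disc-apart from `a`.  Then for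
`0 < δ < g` every upper point `w` of the circle `|w − Re a| = Im a + δ` with `Im φ(w) > 0` lies in the open lens `‖w − Re v‖ < Im v`. -/
theorem bad_subset_lens {η : ℝ} {f : ℂ → ℂ} {x₀ s hmax R Hs : ℝ} {B : ℕ} (hE : EngineHyps5 2 η f x₀ s hmax R Hs B) {j : ℕ} {a v : ℂ}
    (ha : iteratedDeriv j f a = 0) (hapos : 0 < a.im) (hv : iteratedDeriv j f v = 0) (hvpos : 0 < v.im)
    (hvs : iteratedDeriv (j + 1) f v ≠ 0)
    (hfar : ∀ c : ℂ, iteratedDeriv j f c = 0 → 0 < c.im → c ≠ a → c ≠ v → a.im + c.im < |a.re - c.re|) :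
    ∃ g > 0, ∀ δ ∈ Ioo 0 g, ∀ t : ℝ, 0 < (circleLoop (a.re : ℂ) (a.im + δ) t).im → 0 < (arcPhi f j a δ t).im →
      ‖circleLoop (a.re : ℂ) (a.im + δ) t - (v.re : ℂ)‖ < v.im := by
  classical
  have hf : RealEntireLt2 f := realEntireLt2_of_hyps hE
  set G : ℂ → ℂ := iteratedDeriv j f with hGdef
  have hG : RealEntireLt2 G := RhW08.WindowLoss.realEntireLt2_iteratedDeriv hf j
  have e1 : deriv G = iteratedDeriv (j + 1) f := by rw [hGdef, ← iteratedDeriv_succ]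
  have hnz : G ≠ 0 := by
    intro h0
    apply hvs
    rw [← e1, h0]; simp
  have hstrip : ∀ c : ℂ, G c = 0 → |c.im| ≤ Hs := fun c hc => abs_im_le_of_level hE hnz hc
  have haHs : a.im ≤ Hs := by have := hstrip a ha; rwa [abs_of_pos hapos] at this
  obtain ⟨g, hg0, -, hgap⟩ := exists_uniform_far_gap hG.diff hnz hstrip hapos haHs
  -- global pair removal `G = pairQ · h`, `h(v) ≠ 0` by simplicity
  obtain ⟨h, hhd, ⟨ρ, C, hρ0, hρ, hgr⟩, hreal, hfac⟩ := RhW08.NestedSign.exists_cofactor hG hv hvpos.ne'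
  have hderiv : ∀ z, deriv G z = 2 * (z - v.re) * h z + pairQ v.re v.im z * deriv h z := by
    intro z
    have e : G = pairQ v.re v.im * h := funext fun u => by rw [Pi.mul_apply]; exact hfac u
    have hq : HasDerivAt (pairQ v.re v.im) (2 * (z - v.re)) z := RhW07.Law421.SuccessorCertificate.hasDerivAt_quadP v.re v.im z
    have hp := hq.mul (hhd z).hasDerivAt
    rw [e, hp.deriv]
  have hqv : pairQ v.re v.im v = 0 := by
    have e : v - (v.re : ℂ) = (v.im : ℂ) * I := by apply Complex.ext <;> simp
    rw [pairQ, e, mul_pow, Complex.I_sq]; ring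
  have hhv : h v ≠ 0 := by
    intro h0
    apply hvs
    rw [← e1, hderiv v, h0, hqv]; simp
  have hhvbar : h (conj v) ≠ 0 := by rw [apply_conj_eq_conj hhd hreal, map_ne_zero]; exact hhv
  refine ⟨g, hg0, fun δ hδ t hwim hφ => ?_⟩
  set w : ℂ := circleLoop (a.re : ℂ) (a.im + δ) t with hwdef
  have hr : 0 < a.im + δ := by linarith [hδ.1]
  have hw : ‖w - (a.re : ℂ)‖ = a.im + δ := by rw [hwdef, norm_circleLoop_sub_center, abs_of_pos hr]
  have hφdef : arcPhi f j a δ t = deriv G w / G w := rfl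
  have hGw : G w ≠ 0 := by
    intro h0
    rw [hφdef, h0, div_zero] at hφ
    simp at hφ
  have hqw : pairQ v.re v.im w ≠ 0 := by
    intro h0; apply hGw; rw [hfac w, h0, zero_mul]
  have hhw : h w ≠ 0 := by
    intro h0; apply hGw; rw [hfac w, h0, mul_zero]
  -- `w` is Jensen-clear for `h`
  have hout : ∀ z, h z = 0 → |z.im| < ‖w - (z.re : ℂ)‖ := by
    intro z hz
    have hGz : G z = 0 := by rw [hfac z, hz, mul_zero]
    have hzv : z ≠ v := by rintro rfl; exact hhv hz
    have hzvbar : z ≠ conj v := by rintro rfl; exact hhvbar hz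
    rcases lt_trichotomy z.im 0 with hneg | hzero | hposz
    · have hGc : G (conj z) = 0 := by rw [apply_conj_eq_conj hG.diff hG.real, hGz, map_zero]
      have hcim : 0 < (conj z).im := by rw [Complex.conj_im]; linarith
      have hcre : (conj z).re = z.re := Complex.conj_re z
      have habs : |(conj z).im| = |z.im| := by rw [Complex.conj_im, abs_neg]
      by_cases hca : conj z = a
      · have e2 : z.re = a.re := by rw [← hcre, hca]
        have e3 : |z.im| = a.im := by rw [← habs, hca, abs_of_pos hapos]
        rw [e2, e3, hw]
        linarith [hδ.1]
      · have hcv : conj z ≠ v := fun e => hzvbar (by rw [← e, Complex.conj_conj])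
        have hlt := hfar (conj z) hGc hcim hca hcv
        have hgap' := hgap (conj z) hGc (by rwa [abs_of_pos hcim])
        have := im_lt_norm_sub_of_gap hw hδ.2 hgap'
        rwa [habs, hcre] at this
    · rw [hzero, abs_zero]
      have h1 : |w.im| ≤ ‖w - (z.re : ℂ)‖ := by
        have := abs_im_le_norm (w - (z.re : ℂ)); rwa [sub_im, ofReal_im, sub_zero] at this
      rw [abs_of_pos hwim] at h1
      linarith
    · by_cases hza : z = a
      · rw [hza, hw, abs_of_pos hapos]
        linarith [hδ.1]
      · have hlt := hfar z hGz hposz hza hzv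
        have hgap' := hgap z hGz (by rwa [abs_of_pos hposz])
        exact im_lt_norm_sub_of_gap hw hδ.2 hgap'
  -- Jensen sign lemma for the cofactor
  have hsign := RhW08.NestedSign.im_mul_im_logDeriv_nonpos hhd hρ0 hρ hgr hreal hhw hout
  have hKh : (deriv h w / h w).im ≤ 0 := by
    by_contra hp
    push Not at hp
    have := mul_pos hwim hp
    linarith
  -- `φ = 2(w − Re v)/pairQ(w) + h′/h(w)`, so the pair term has positive imaginary part
  have hφeq : arcPhi f j a δ t = 2 * (w - v.re) / pairQ v.re v.im w + deriv h w / h w := by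
    rw [hφdef, hderiv w, hfac w]
    field_simp
  have hpair : 0 < (2 * (w - v.re) / pairQ v.re v.im w).im := by
    have : (arcPhi f j a δ t).im = (2 * (w - v.re) / pairQ v.re v.im w).im + (deriv h w / h w).im := by rw [hφeq, add_im]
    linarith
  -- ⇒ `w ∈ D_v`
  set K : ℂ := -(2 * (w - v.re) / pairQ v.re v.im w) with hK
  have hcrit : pairQ v.re v.im w * K = -(2 * (w - v.re)) := by
    rw [hK, mul_neg, mul_div_cancel₀ _ hqw]
  have hid := RhW08.NestedSign.im_mul_normSq_of_crit hvpos.ne' hcrit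
  have hKim : K.im < 0 := by rw [hK, neg_im]; linarith
  have hprod : K.im * Complex.normSq (pairQ v.re v.im w) < 0 := mul_neg_of_neg_of_pos hKim (Complex.normSq_pos.2 hqw)
  rw [hid] at hprod
  have h2 : 0 < 2 * w.im * (v.im ^ 2 - ((w.re - v.re) ^ 2 + w.im ^ 2)) := by linarith
  have hsq : (w.re - v.re) ^ 2 + w.im ^ 2 < v.im ^ 2 := by
    have := (mul_pos_iff_of_pos_left (by linarith : (0 : ℝ) < 2 * w.im)).1 h2
    linarith
  have e : ‖w - (v.re : ℂ)‖ ^ 2 = (w.re - v.re) ^ 2 + w.im ^ 2 := by rw [Complex.sq_norm, Complex.normSq_apply]; simp; ring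
  exact (pow_lt_pow_iff_left₀ (norm_nonneg _) hvpos.le two_ne_zero).1 (by rw [e]; exact hsq)

/-- ★ BadInLens on the ATOMIC class (part Jʼs `Atomic`; only its zero / positivity / off-chain-from-`a` clauses are used). -/
theorem bad_subset_lens_of_atomic {η : ℝ} {f : ℂ → ℂ} {x₀ s hmax R Hs : ℝ} {B : ℕ} (hE : EngineHyps5 2 η f x₀ s hmax R Hs B) {j : ℕ}
    {a v : ℂ} (ha : iteratedDeriv j f a = 0) (hapos : 0 < a.im) (hA : Atomic f j a v) (hvs : iteratedDeriv (j + 1) f v ≠ 0) :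
    ∃ g > 0, ∀ δ ∈ Ioo 0 g, ∀ t : ℝ, 0 < (circleLoop (a.re : ℂ) (a.im + δ) t).im → 0 < (arcPhi f j a δ t).im →
      ‖circleLoop (a.re : ℂ) (a.im + δ) t - (v.re : ℂ)‖ < v.im :=
  bad_subset_lens hE ha hapos hA.1 hA.2.1 hvs fun c hc hcpos hca hcv => (hA.2.2.2.2.2 c hc hcpos hca hcv).1

/-! ## §3 ORDER and the reduction ORDER ⇒ SHAPE -/

/-- ORDER at radius excess `δ` (C6 g37 §2.6 «hi_i ≤ lo_j», tilt included): for bad pieces `(t₁,t₂)`, `(t₃,t₄)` of the upper semicircle with `t₂ ≤ t₃`,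
`Re φ(t₂) ≤ Re φ(t₃)` — the `Re φ`-values at the piece ends are ordered along the semicircle.  Mirror-invariant (`t ↦ ½ − t`, `Re φ ↦ −Re φ`). -/
def ArcOrder (f : ℂ → ℂ) (j : ℕ) (a : ℂ) (δ : ℝ) : Prop :=
  ∀ t₁ t₂ t₃ t₄ : ℝ, BadPiece f j a δ t₁ t₂ → BadPiece f j a δ t₃ t₄ → t₂ ≤ t₃ → (arcPhi f j a δ t₂).re ≤ (arcPhi f j a δ t₃).re

/-- ★ THE ATOMIC ORDER LAW (OPEN; NEEDS NEW INPUT — nodal topology (i)/(ii); census 0 / 5 845, 174/174): on a legal frame, a top upper zero `a` with an atomic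
mate `v`, both simple, has ORDERED piece ends on every small Jensen circle outside finitely many radii. -/
def AtomicOrderLawQ : Prop :=
  ∀ (η : ℝ) (f : ℂ → ℂ) (x₀ s hmax R Hs : ℝ) (B : ℕ), EngineHyps5 2 η f x₀ s hmax R Hs B → ∀ (j : ℕ) (a v : ℂ),
    iteratedDeriv j f a = 0 → 0 < a.im → NoTallerToucher f j a → Atomic f j a v →
    iteratedDeriv (j + 1) f a ≠ 0 → iteratedDeriv (j + 1) f v ≠ 0 → ∃ d0 > 0, ∃ E : Set ℝ, E.Finite ∧ ∀ δ ∈ Ioo 0 d0 \ E, ArcOrder f j a δ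

/-- ★ ORDER ⇒ at most ONE ascending bad piece (two ascending pieces `P < P′` would give `Re φ(end P) > 0 > Re φ(start P′)`, against ORDER). -/
theorem ascStarts_subsingleton_of_order {f : ℂ → ℂ} {j : ℕ} {a : ℂ} {δ : ℝ} (hO : ArcOrder f j a δ) : (ascStarts f j a δ).Subsingleton := by
  intro t₁ ht₁ t₁' ht₁'
  obtain ⟨t₂, hP, hre1, hre2⟩ := ht₁
  obtain ⟨t₂', hP', hre1', hre2'⟩ := ht₁'
  by_contra hne
  rcases lt_or_gt_of_ne hne with hlt | hlt
  · have h23 : t₂ ≤ t₁' := by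
      by_contra hgt
      push Not at hgt
      have := hP.2.2.2.1 t₁' ⟨hlt, hgt⟩
      linarith [hP'.2.2.2.2.1]
    have := hO t₁ t₂ t₁' t₂' hP hP' h23
    linarith
  · have h23 : t₂' ≤ t₁ := by
      by_contra hgt
      push Not at hgt
      have := hP'.2.2.2.1 t₁ ⟨hlt, hgt⟩
      linarith [hP.2.2.2.2.1]
    have := hO t₁' t₂' t₁ t₂ hP' hP h23
    linarith

/-- A subsingleton set of reals is finite with `ncard ≤ 1`. -/
theorem finite_and_ncard_le_one {S : Set ℝ} (hS : S.Subsingleton) : S.Finite ∧ S.ncard ≤ 1 := by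
  refine ⟨hS.finite, ?_⟩
  rcases hS.eq_empty_or_singleton with h | ⟨x, h⟩
  · rw [h, Set.ncard_empty]; exact zero_le_one
  · rw [h, Set.ncard_singleton]

/-- ORDER on the small circles ⇒ `AscLeOne`. -/
theorem ascLeOne_of_order {f : ℂ → ℂ} {j : ℕ} {a : ℂ} (h : ∃ d0 > 0, ∃ E : Set ℝ, E.Finite ∧ ∀ δ ∈ Ioo 0 d0 \ E, ArcOrder f j a δ) :
    AscLeOne f j a := by
  obtain ⟨d0, hd0, E, hE, hO⟩ := h
  exact ⟨d0, hd0, E, hE, fun δ hδ => finite_and_ncard_le_one (ascStarts_subsingleton_of_order (hO δ hδ))⟩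

/-- ★★ THE REDUCTION: the atomic ORDER law gives the atomic SHAPE law. -/
theorem atomicShapeLaw_of_orderLaw (hO : AtomicOrderLawQ) : AtomicShapeLawQ :=
  fun η f x₀ s hmax R Hs B hE j a v ha hapos hN hA hda hdv => ascLeOne_of_order (hO η f x₀ s hmax R Hs B hE j a v ha hapos hN hA hda hdv)

/-- … hence ORDER + the non-atomic residual give part Iʼs residual (via part Jʼs split) … -/
theorem topPinningResidual_of_orderSplit (hO : AtomicOrderLawQ) (hR : NonAtomicTopResidualQ) : TopPinningNonNestedAscResidual :=
  topPinningResidual_of_split (atomicShapeLaw_of_orderLaw hO) hR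

/-- … and `TopPinning`. -/
theorem topPinning_of_orderSplit (hO : AtomicOrderLawQ) (hR : NonAtomicTopResidualQ) : TopPinning :=
  topPinning_of_split (atomicShapeLaw_of_orderLaw hO) hR

end RhW08.Lens1ArcSign
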